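import Literature.MathematicalPhysics.KineticTheory.HardSphereEulerProofs

/-!
# `dLG/dG` for a pure activity tilt (negative-side helper, crux stmt-AtomisticToContinuum-14914,
route InformationPercolationEngine)

The local Gibbs law with activity `a₀`, zero drift and unit temperature is EXACTLY the invariant
canonical law `G = localGibbsMeasure σ 1 0 1 N` reweighted by the positional tilt
`(Z_G/Z_{LG}) ∏_k a₀(x_k)`:
`localGibbsMeasure σ a₀ 0 1 N = G.withDensity ((Z_G/Z_{LG}) ∏_k a₀(x_k))`
(`localGibbsMeasure_activityTilt_eq_withDensity`; through any flow, `localGibbsLaw_activityTilt_eq_withDensity`).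
This is the first line of the disprover's fixed-`r` mechanism against `KickFairRelEquilibrium`
(`Negative/KickFairRelEquilibriumFalseOfSubcellClusteringBias.lean`, `H = SubcellClusteringBiasPersists`):
for such data the defect of the compensated kick sum is the `G`-conditional covariance, given the
typed past, between this tilt and the kick, `E_{LG}[h(P)(g − κ)] = E_G[h(P) · Cov_G(ρ, g(X) | σ(P))]`
with `ρ = dLG/dG`. It is also the honest form of the transfer `G → LG` for activity-only data (no
`Λ^{N+1}` loss). refuter-cdisprove-stmt-AtomisticToContinuum-14914-0. No route statement is asserted.
-/

open MeasureTheory Set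
open scoped ENNReal BigOperators

namespace Summit.AtomisticToContinuum.HydrodynamicLimit.Theorems.KickFairRelEquilibriumNegative

noncomputable section

open Literature.MathematicalPhysics.KineticTheory
open Literature.Analysis.FluidPDE (canonicalPartition canonicalDensity tensorPow hardSphereDomain
  HardSphereFlow)

/-- **`dLG/dG` for a pure activity tilt.** For a continuous activity `a₀ > 0`, zero drift, unit
temperature and `σ ≤ 1/2` (both partition functions positive):
`localGibbsMeasure σ a₀ 0 1 N = (localGibbsMeasure σ 1 0 1 N).withDensity ((Z_G/Z_{LG}) ∏_k a₀(x_k))`,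
`Z_G = posPartition 1`, `Z_{LG} = posPartition a₀` (the Maxwellian factors are common and cancel).
[folklore] -/
theorem localGibbsMeasure_activityTilt_eq_withDensity {a₀ : T3 → ℝ} (ha : Continuous a₀)
    (ha0 : ∀ x, 0 < a₀ x) {σ : ℝ} (hσ2 : σ ≤ 1 / 2) (N : ℕ) :
    localGibbsMeasure σ a₀ (fun _ => 0) (fun _ => 1) N =
      (localGibbsMeasure σ (fun _ => 1) (fun _ => 0) (fun _ => 1) N).withDensity fun z =>
        ENNReal.ofReal (posPartition (fun _ => (1 : ℝ)) (hsDiameter σ N) (N + 1) /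
            posPartition a₀ (hsDiameter σ N) (N + 1) * ∏ k, a₀ (z k).1) := by
  have hZG : canonicalPartition (Literature.Analysis.FluidPDE.Torus.geometry (Fin 3)) (hsDiameter σ N) (N + 1)
      (localGibbsProfile (fun _ => 1) (fun _ => 0) (fun _ => 1)) =
        posPartition (fun _ => (1 : ℝ)) (hsDiameter σ N) (N + 1) :=
    canonicalPartition_eq_posPartition continuous_const continuous_const continuous_const
      (fun _ => zero_le_one) (fun _ => one_pos) (hsDiameter σ N) (N + 1)
  have hZL : canonicalPartition (Literature.Analysis.FluidPDE.Torus.geometry (Fin 3)) (hsDiameter σ N) (N + 1)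
      (localGibbsProfile a₀ (fun _ => 0) (fun _ => 1)) = posPartition a₀ (hsDiameter σ N) (N + 1) :=
    canonicalPartition_eq_posPartition ha continuous_const continuous_const (fun x => (ha0 x).le)
      (fun _ => one_pos) (hsDiameter σ N) (N + 1)
  have hPG : 0 < posPartition (fun _ => (1 : ℝ)) (hsDiameter σ N) (N + 1) :=
    posPartition_pos continuous_const (fun _ => one_pos) hσ2 N
  have hPL : 0 < posPartition a₀ (hsDiameter σ N) (N + 1) := posPartition_pos ha ha0 hσ2 N
  -- measurability of the two densities
  have hf : Measurable fun z : Literature.Analysis.FluidPDE.Config (N + 1) (Fin 3) T3 =>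
      ENNReal.ofReal (canonicalDensity (Literature.Analysis.FluidPDE.Torus.geometry (Fin 3)) (hsDiameter σ N) (N + 1)
        (localGibbsProfile (fun _ => 1) (fun _ => 0) (fun _ => 1)) z) :=
    (measurable_canonicalDensity (hsDiameter σ N) (N + 1)
      (measurable_localGibbsProfile continuous_const continuous_const continuous_const)).ennreal_ofReal
  have hprod : Measurable fun z : Literature.Analysis.FluidPDE.Config (N + 1) (Fin 3) T3 =>
      ∏ k, a₀ (z k).1 := by
    refine Finset.measurable_prod _ fun k _ => ?_
    exact ha.measurable.comp (measurable_pi_apply k).fst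
  have hg : Measurable fun z : Literature.Analysis.FluidPDE.Config (N + 1) (Fin 3) T3 =>
      ENNReal.ofReal (posPartition (fun _ => (1 : ℝ)) (hsDiameter σ N) (N + 1) / posPartition a₀ (hsDiameter σ N) (N + 1) *
        ∏ k, a₀ (z k).1) :=
    (measurable_const.mul hprod).ennreal_ofReal
  -- nonnegativity of the invariant density
  have hG0 : ∀ z, 0 ≤ canonicalDensity (Literature.Analysis.FluidPDE.Torus.geometry (Fin 3)) (hsDiameter σ N) (N + 1)
      (localGibbsProfile (fun _ => 1) (fun _ => 0) (fun _ => 1)) z := fun z =>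
    mul_nonneg (inv_nonneg.2 (canonicalPartition_nonneg _ _ _
      (fun y => localGibbsProfile_nonneg (fun _ => zero_le_one) (fun _ => zero_le_one) y)))
      (Set.indicator_nonneg (fun w _ => Literature.Analysis.FluidPDE.tensorPow_nonneg
        (fun y => localGibbsProfile_nonneg (fun _ => zero_le_one) (fun _ => zero_le_one) y) _ w) z)
  unfold localGibbsMeasure
  rw [← withDensity_mul _ hf hg]
  congr 1
  funext z
  simp only [Pi.mul_apply]
  rw [← ENNReal.ofReal_mul (hG0 z)]
  congr 1
  simp only [canonicalDensity, hZG, hZL]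
  by_cases hz : z ∈ hardSphereDomain (Literature.Analysis.FluidPDE.Torus.geometry (Fin 3)) (N + 1) (hsDiameter σ N)
  · simp only [Set.indicator_of_mem hz, tensorPow, localGibbsProfile, one_mul]
    rw [Finset.prod_mul_distrib]
    field_simp
  · simp only [Set.indicator_of_notMem hz, mul_zero, zero_mul]

/-- The same identity for the laws through any flow (`localGibbsLaw_eq`). [folklore] -/
theorem localGibbsLaw_activityTilt_eq_withDensity {a₀ : T3 → ℝ} (ha : Continuous a₀)
    (ha0 : ∀ x, 0 < a₀ x) {σ : ℝ} (hσ2 : σ ≤ 1 / 2) (N : ℕ)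
    (Φ : HardSphereFlow (Literature.Analysis.FluidPDE.Torus.geometry (Fin 3)) (hsDiameter σ N) (N + 1)) :
    localGibbsLaw σ a₀ (fun _ => 0) (fun _ => 1) N Φ =
      (localGibbsLaw σ (fun _ => 1) (fun _ => 0) (fun _ => 1) N Φ).withDensity fun z =>
        ENNReal.ofReal (posPartition (fun _ => (1 : ℝ)) (hsDiameter σ N) (N + 1) /
            posPartition a₀ (hsDiameter σ N) (N + 1) * ∏ k, a₀ (z k).1) := by
  rw [localGibbsLaw_eq, localGibbsLaw_eq]
  exact localGibbsMeasure_activityTilt_eq_withDensity ha ha0 hσ2 N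

/-- **Change of measure for lower integrals**: `∫⁻ F dLG = ∫⁻ F · ρ dG` with the activity tilt
`ρ = (Z_G/Z_{LG}) ∏_k a₀(x_k)` (no `Λ^{N+1}` loss, cf. the line's Stage 1), for measurable `F`.
[folklore] -/
theorem lintegral_localGibbsMeasure_activityTilt {a₀ : T3 → ℝ} (ha : Continuous a₀)
    (ha0 : ∀ x, 0 < a₀ x) {σ : ℝ} (hσ2 : σ ≤ 1 / 2) (N : ℕ)
    {F : Literature.Analysis.FluidPDE.Config (N + 1) (Fin 3) T3 → ℝ≥0∞} (hF : Measurable F) :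
    ∫⁻ z, F z ∂(localGibbsMeasure σ a₀ (fun _ => 0) (fun _ => 1) N) =
      ∫⁻ z, ENNReal.ofReal (posPartition (fun _ => (1 : ℝ)) (hsDiameter σ N) (N + 1) /
            posPartition a₀ (hsDiameter σ N) (N + 1) * ∏ k, a₀ (z k).1) * F z
        ∂(localGibbsMeasure σ (fun _ => 1) (fun _ => 0) (fun _ => 1) N) := by
  have hprod : Measurable fun z : Literature.Analysis.FluidPDE.Config (N + 1) (Fin 3) T3 =>
      ∏ k, a₀ (z k).1 := by
    refine Finset.measurable_prod _ fun k _ => ?_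
    exact ha.measurable.comp (measurable_pi_apply k).fst
  have hg : Measurable fun z : Literature.Analysis.FluidPDE.Config (N + 1) (Fin 3) T3 =>
      ENNReal.ofReal (posPartition (fun _ => (1 : ℝ)) (hsDiameter σ N) (N + 1) /
        posPartition a₀ (hsDiameter σ N) (N + 1) * ∏ k, a₀ (z k).1) :=
    (measurable_const.mul hprod).ennreal_ofReal
  rw [localGibbsMeasure_activityTilt_eq_withDensity ha ha0 hσ2 N,
    lintegral_withDensity_eq_lintegral_mul _ hg hF]
  simp only [Pi.mul_apply]

end

end Summit.AtomisticToContinuum.HydrodynamicLimit.Theorems.KickFairRelEquilibriumNegative
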